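import Summits.PneNP.PneNP.Theorems.Sd2BlMachineRawLegs

/-!
# Sign-degree-2 engine, MACHINE LAYER G2 (dictionary records): the raw leg of a certificate leg (cell pnp-ideate,
# ROUND-18 item K1'' `SignDeg2Signing.SignDeg2SigningFP`, stage S3)

FRONTIER (range avoidance for sign-degree-≤2 local maps at linear stretch; restricted-model algorithmic
rung); nothing here bears on P vs NP.

Math-side records linking the machine's raw leg list `Sd2BlMachine.rawLegs` (G2) to the certificate leg system
`SignDeg2Legs.CLeg c` of the K1'' interface `sigCertified_of_legBound`, for the dictionary (pieces / owners /
decomposition) of the closer: the OWNER CODE `ownerCode (v?, b) = 2·(none ↦ 0 | some v ↦ v+1) + b` (injective);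
`rawOf I c e` = the raw leg `(j, kindIdx κ + K·r, ownerCode (srcOwner I j κ), ownerCode (dstOwner I c j κ))` of
`e = (j, κ, r)` (`rawOf_out`, `rawOf_tag`, **`rawOf_lv`**, **`rawOf_rv`**, `rawOf_injective`); and, when the three
coefficient tables give the certificate's coefficients (`hF : coef c j κ = coefF k F0 F1 F2 (I.table j) κ` — for
the canonical certificate this is prover-1's `canonCert_c0/_c1/_c2` with `rowTable₂`),
**`mem_rawLegs_iff : x ∈ rawLegs k F0 F1 F2 (decode k I.encode) ↔ ∃ e, rawOf I c e = x`** and **`nodup_rawLegs`**.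
-/

set_option linter.dupNamespace false -- `Summit.PneNP.PneNP.…`: summit = sub-problem name (D-0017 single-conjunct layout)

namespace Summit.PneNP.PneNP.Theorems.Sd2BlMachine

open Literature.Computability.Complexity
open Summit.PneNP.PneNP.Theorems.SfmBlMachine
open Summit.PneNP.PneNP.Theorems.SignRepCertificate (Cert)
open Summit.PneNP.PneNP.Theorems.SignDeg2Legs
open Summit.PneNP.PneNP.Theorems.LocalMapDecodeFP (decode decode_encode)
open Summit.PneNP.PneNP.Theorems.MajLocalAvoidFP (rowOf getD_rowOf length_rowOf)

/-! ## Owner codes -/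

/-- THE OWNER CODE of `(vertex?, bit)`: `2·(none ↦ 0 | some v ↦ v+1) + bit`. -/
def ownerCode {n : ℕ} (o : Option (Fin n) × Bool) : ℕ :=
  2 * (o.1.elim 0 fun v => v.val + 1) + (if o.2 then 1 else 0)

/-- `ownerCode` is injective. -/
theorem ownerCode_injective {n : ℕ} : Function.Injective (ownerCode (n := n)) := by
  rintro ⟨v, b⟩ ⟨v', b'⟩ h
  simp only [ownerCode] at h
  have hb : (if b then 1 else 0 : ℕ) = (if b' then 1 else 0) := by
    cases b <;> cases b' <;> simp at h ⊢ <;> omega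
  have hv : (v.elim 0 fun v => v.val + 1 : ℕ) = v'.elim 0 fun v => v.val + 1 := by
    cases b <;> cases b' <;> simp at h hb ⊢ <;> omega
  refine Prod.ext ?_ ?_
  · cases v with
    | none => cases v' with
      | none => rfl
      | some w => simp at hv
    | some w => cases v' with
      | none => simp at hv
      | some w' => simp only [Option.elim_some, add_left_inj] at hv; exact congrArg some (Fin.ext hv)
  · cases b <;> cases b' <;> simp at hb ⊢

/-! ## The raw leg of a certificate leg (math-side records) -/

section MathSide

variable {k n m : ℕ} (I : LocalMap k n m) (c : Cert I)

/-- THE RAW LEG of a certificate leg `e = (j, κ, r)`: `(j, kindIdx κ + K·r, ownerCode src, ownerCode dst)`,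
realised through `mkRaw` at the positions `rowOf I j`. -/
def rawOf (e : CLeg c) : RLeg :=
  mkRaw e.out.val (rowOf I e.out)
    (kindIdx k e.kind + nKinds k * e.2.2.val, srcSel e.kind, roleBit e.kind, dstSel e.kind, sgnBit (coef c e.out e.kind))

/-- Its output field. -/
theorem rawOf_out (e : CLeg c) : (rawOf I c e).1 = e.out.val := rfl

/-- Its tag field. -/
theorem rawOf_tag (e : CLeg c) : (rawOf I c e).2.1 = kindIdx k e.kind + nKinds k * e.2.2.val := rfl

/-- `selV` at a slot selector reads the variable of that slot. -/
theorem selV_rowOf_succ (j : Fin m) (i : Fin k) : selV (rowOf I j) (i.val + 1) = (I.vars j i).val + 1 := by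
  rw [selV, if_neg (Nat.succ_ne_zero _), Nat.add_sub_cancel, getD_rowOf]

/-- **Its left owner code is the code of `srcOwner`.** -/
theorem rawOf_lv (e : CLeg c) : (rawOf I c e).2.2.1 = ownerCode (srcOwner I e.out e.kind) := by
  obtain ⟨j, κ, r⟩ := e
  show 2 * selV (rowOf I j) (srcSel κ) + roleBit κ = ownerCode (srcOwner I j κ)
  rcases κ with _ | i | ⟨i, i'⟩
  · simp [srcSel, roleBit, srcOwner, ownerCode, selV]
  · rw [show srcSel (Sum.inr (Sum.inl i) : Kind k) = i.val + 1 from rfl, selV_rowOf_succ]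
    simp [roleBit, srcOwner, ownerCode]
  · rw [show srcSel (Sum.inr (Sum.inr (i, i')) : Kind k) = i.val + 1 from rfl, selV_rowOf_succ]
    simp [roleBit, srcOwner, ownerCode]

/-- **Its right owner code is the code of `dstOwner`.** -/
theorem rawOf_rv (e : CLeg c) : (rawOf I c e).2.2.2 = ownerCode (dstOwner I c e.out e.kind) := by
  obtain ⟨j, κ, r⟩ := e
  show 2 * selV (rowOf I j) (dstSel κ) + sgnBit (coef c j κ) = ownerCode (dstOwner I c j κ)
  have hs : ∀ (z : ℤ), sgnBit z = (if decide (z < 0) then 1 else 0 : ℕ) := fun z => by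
    simp only [sgnBit, decide_eq_true_eq]
  rcases κ with u | i | ⟨i, i'⟩
  · simp [dstSel, dstOwner, dstVert, ownerCode, selV, hs]
  · simp [dstSel, dstOwner, dstVert, ownerCode, selV, hs]
  · rw [show dstSel (Sum.inr (Sum.inr (i, i')) : Kind k) = i'.val + 1 from rfl, selV_rowOf_succ]
    simp [dstOwner, dstVert, ownerCode, hs]

/-- `rawOf` is injective (the output and the tag determine the leg). -/
theorem rawOf_injective : Function.Injective (rawOf I c) := by
  rintro ⟨j, κ, r⟩ ⟨j', κ', r'⟩ h
  have h1 : j = j' := Fin.ext (congrArg Prod.fst h)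
  subst h1
  have h2 := congrArg (fun x => x.2.1) h
  simp only [rawOf, mkRaw, CLeg.kind] at h2
  obtain ⟨hκ, hr⟩ := tag_injective k h2
  subst hκ
  have : r = r' := Fin.ext hr
  subst this
  rfl

variable (F0 : ((Fin k → Bool) → Bool) → ℤ) (F1 : ((Fin k → Bool) → Bool) → Fin k → ℤ)
  (F2 : ((Fin k → Bool) → Bool) → Fin k → Fin k → ℤ)
  (hF : ∀ (j : Fin m) (κ : Kind k), coef c j κ = coefF k F0 F1 F2 (I.table j) κ)
include hF

/-- Under `hF` the template of `(κ, r)` at output `j` is the machine's. -/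
theorem tmplKR_eq (j : Fin m) (κ : Kind k) (r : ℕ) :
    tmplKR k F0 F1 F2 (I.table j) (κ, r) = (kindIdx k κ + nKinds k * r, srcSel κ, roleBit κ, dstSel κ, sgnBit (coef c j κ)) := by
  simp only [tmplKR, hF]

/-- **MEMBERSHIP**: the raw legs of the code of `I` are exactly the raw legs of the certificate legs. -/
theorem mem_rawLegs_iff (x : RLeg) :
    x ∈ rawLegs k F0 F1 F2 (decode k I.encode) ↔ ∃ e : CLeg c, rawOf I c e = x := by
  rw [rawLegs_decode]
  simp only [List.mem_flatten, List.mem_map, List.mem_finRange, true_and, exists_exists_eq_and]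
  constructor
  · rintro ⟨j, tp, htp, rfl⟩
    obtain ⟨κ, r, hr, rfl⟩ := (mem_templatesOf_iff k F0 F1 F2 _ tp).1 htp
    rw [← hF] at hr
    refine ⟨⟨j, κ, ⟨r, hr⟩⟩, ?_⟩
    rw [tmplKR_eq I c F0 F1 F2 hF]
    rfl
  · rintro ⟨⟨j, κ, r⟩, rfl⟩
    refine ⟨j, tmplKR k F0 F1 F2 (I.table j) (κ, r.val), ?_, ?_⟩
    · exact (mem_templatesOf_iff k F0 F1 F2 _ _).2 ⟨κ, r.val, by rw [← hF]; exact r.isLt, rfl⟩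
    · rw [tmplKR_eq I c F0 F1 F2 hF]; rfl

omit hF in
/-- `mkRaw j pos` is injective on a template list without duplicate tags, e.g. `templatesOf`. -/
theorem nodup_map_mkRaw (P : (Fin k → Bool) → Bool) (j : ℕ) (pos : List ℕ) :
    ((templatesOf k F0 F1 F2 P).map (mkRaw j pos)).Nodup := by
  refine (nodup_templatesOf k F0 F1 F2 P).map_on fun tp htp tp' htp' h => ?_
  obtain ⟨κ, r, _, rfl⟩ := (mem_templatesOf_iff k F0 F1 F2 P tp).1 htp
  obtain ⟨κ', r', _, rfl⟩ := (mem_templatesOf_iff k F0 F1 F2 P tp').1 htp'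
  have h1 := congrArg (fun x : RLeg => x.2.1) h
  simp only [mkRaw, tmplKR] at h1
  obtain ⟨hκ, hr⟩ := tag_injective k h1
  rw [hκ, hr]

omit hF in
/-- **The raw legs of the code of an instance have no duplicates.** -/
theorem nodup_rawLegs : (rawLegs k F0 F1 F2 (decode k I.encode)).Nodup := by
  rw [rawLegs_decode, List.nodup_flatten]
  constructor
  · intro l hl
    obtain ⟨j, _, rfl⟩ := List.mem_map.1 hl
    exact nodup_map_mkRaw F0 F1 F2 (I.table j) j.val (rowOf I j)
  · rw [List.pairwise_map]
    refine (List.nodup_finRange m).imp_of_mem ?_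
    intro j j' _ _ hne x hx hx'
    obtain ⟨tp, _, rfl⟩ := List.mem_map.1 hx
    obtain ⟨tp', _, h⟩ := List.mem_map.1 hx'
    have := congrArg Prod.fst h
    simp only [mkRaw] at this
    exact hne (Fin.ext this.symm)

end MathSide


end Summit.PneNP.PneNP.Theorems.Sd2BlMachine
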